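import Literature.Analysis.ODE.LinearObservability
import Literature.MathematicalPhysics.KineticTheory.LangevinChainLimitFlow
import HarnessLib

/-!
# Observability of a damped harmonic block from the friction at its last site

Topic `Literature/MathematicalPhysics/KineticTheory`, grouping namespace `…KineticTheory.HeatConduction`.
The HOST BLOCK of a heat-conduction chain: `n ≥ 1` unit masses `j = 0, …, n-1` with harmonic
pinning `ω₂ q_j²/2` (`ω₂ > 0`), unit harmonic nearest-neighbour bonds, friction `γ` at the last
site `n-1` and the first site tied by a unit harmonic bond to a PRESCRIBED position `u(t)` (the
interface site of the chain it is cut from); noise `ξ(t)` may enter the last momentum additively.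
In phase space `PhaseSpace n = (Fin n → ℝ) × (Fin n → ℝ)` the linear part is the operator
`A(q, p) = (p, F(q) - γ p_{n-1} e_{n-1})` with the force
`F_j(q) = -ω₂ q_j + [j+1 < n](q_{j+1} - q_j) - [0 < j](q_j - q_{j-1}) - [j = 0] q_j`.

* `exists_hostBlockOp` — `A` as a continuous linear operator (the file is theorem-only: `A` is
  then a hypothesis `(A, hA : ∀ X, A X = …)` of the later statements);
* `hostBlock_sum_mul_force_le` — the virial inequality `∑_j q_j F_j(q) ≤ -ω₂ ∑_j q_j²`
  (summation by parts: the bond terms regroup into `-∑ (q_{j+1} - q_j)² - q_0²`), whence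
  `hostBlock_eq_zero_of_force_eq_zero`: the static problem `F(q) = 0` has only the solution
  `q = 0`;
* `hostBlock_eq_zero_of_momentum_last_eq_zero` — **rigidity / observability of `(A, p_{n-1})`**:
  if along the free linear flow `exp(tA) X₀` the last momentum vanishes on a window `[0, τ]`,
  `τ > 0`, then `X₀ = 0` (peeling from the right: `p_i ≡ 0 ⇒ ṗ_i ≡ 0 ⇒ p̈_i ≡ 0`, and
  `p̈_i = … + p_{i-1}` once `p_i, p_{i+1} ≡ 0`; at the end `p = 0` and `F(q) = 0`);
* `hostBlock_exists_observabilityConstant` — `∫₀^τ p_{n-1}(t)² dt ≥ c ‖X₀‖²` along the free flow;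
* `hostBlock_observability_forced` — **the forced estimate**: every continuous solution of
  `X(t) = X(0) + (0, ξ(t) e_{n-1}) + ∫₀ᵗ (A X(s) + (0, u(s) e_0)) ds` on `[0, τ]` with `|u| ≤ Mu`,
  `|ξ| ≤ Mξ` there satisfies `∫₀^τ (p_{n-1} - ξ)² ≥ c ‖X(0)‖² - C (Mu² + Mξ²)` (Grönwall comparison
  with the free flow + the observability inequality of `LinearObservability.lean`).

## References

* E. D. Sontag, *Mathematical Control Theory* (1998), §6.2; N. Cuneo, J.-P. Eckmann, M. Hairer,
  L. Rey-Bellet, Electron. J. Probab. **23** (2018) no. 55, Prop. 3.3 (rigidity of oscillator chains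
  observed at a bath site). [folklore]

## Design choices

* Theorem-only (no `def`): the operator is produced by `exists_hostBlockOp` and carried as a
  hypothesis; the observation functional is `X ↦ X.2 ⟨n-1, _⟩`.
* NOT here: the stochastic chain, energies, the identification of the block inside `cellChain`
  (done where it is used), friction at other sites.
-/

noncomputable section

open MeasureTheory Set Filter Topology NormedSpace

namespace Literature.MathematicalPhysics.KineticTheory.HeatConduction

open Literature.Analysis.ODE

variable {n : ℕ}

/-! ### The block operator -/

/-- The linear vector field of the damped harmonic block (pinning `ω₂`, unit bonds, a Dirichlet
bond at site `0`, friction `γ` at site `n-1`) is a continuous linear operator of phase space.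
[folklore] -/
theorem exists_hostBlockOp (ω₂ γ : ℝ) (n : ℕ) :
    ∃ A : PhaseSpace n →L[ℝ] PhaseSpace n, ∀ X : PhaseSpace n,
      A X = (X.2, fun j : Fin n => -(ω₂ * X.1 j) +
        (if h : j.val + 1 < n then X.1 ⟨j.val + 1, h⟩ - X.1 j else 0) -
        (if h : 0 < j.val then X.1 j - X.1 ⟨j.val - 1, by omega⟩ else X.1 j) -
        (if j.val = n - 1 then γ * X.2 j else 0)) := by
  refine ⟨LinearMap.toContinuousLinearMap
    { toFun := fun X : PhaseSpace n => ((X.2, fun j : Fin n => -(ω₂ * X.1 j) +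
        (if h : j.val + 1 < n then X.1 ⟨j.val + 1, h⟩ - X.1 j else 0) -
        (if h : 0 < j.val then X.1 j - X.1 ⟨j.val - 1, by omega⟩ else X.1 j) -
        (if j.val = n - 1 then γ * X.2 j else 0)) : PhaseSpace n)
      map_add' := fun X Y => ?_
      map_smul' := fun c X => ?_ }, fun X => rfl⟩
  · refine Prod.ext (by simp) (funext fun j => ?_)
    simp only [Prod.fst_add, Prod.snd_add, Pi.add_apply]
    split_ifs <;> ring
  · refine Prod.ext (by simp) (funext fun j => ?_)
    simp only [Prod.smul_fst, Prod.smul_snd, Pi.smul_apply, smul_eq_mul, RingHom.id_apply]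
    split_ifs <;> ring

/-! ### The static problem: the force determines the configuration -/

/-- Reindexing a sum over the bonds of a path: summing `g(j-1, j)` over the sites `j > 0` is
summing `g(j, j+1)` over the sites with `j + 1 < n`. [folklore] -/
theorem hostBlock_sum_bond_reindex (g : Fin n → Fin n → ℝ) :
    ∑ j : Fin n, (if h : 0 < j.val then g ⟨j.val - 1, by omega⟩ j else 0) =
      ∑ j : Fin n, (if h : j.val + 1 < n then g j ⟨j.val + 1, h⟩ else 0) := by
  cases n with
  | zero => simp
  | succ m =>
    rw [Fin.sum_univ_succ, Fin.sum_univ_castSucc]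
    have h0 : (if h : 0 < (0 : Fin (m + 1)).val then g ⟨(0 : Fin (m + 1)).val - 1, by omega⟩ 0
        else 0) = 0 := dif_neg (by simp)
    have hl : (if h : (Fin.last m).val + 1 < m + 1 then g (Fin.last m) ⟨(Fin.last m).val + 1, h⟩
        else 0) = 0 := dif_neg (by simp)
    rw [h0, hl, zero_add, add_zero]
    refine Finset.sum_congr rfl fun i _ => ?_
    rw [dif_pos (by simp), dif_pos (by simp)]
    congr 1

/-- **Virial inequality for the block force**:
`∑_j q_j F_j(q) = -ω₂ ∑ q_j² - ∑_{j+1<n} (q_{j+1} - q_j)² - q_0² ≤ -ω₂ ∑_j q_j²`. [folklore] -/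
theorem hostBlock_sum_mul_force_le (ω₂ : ℝ) (q : Fin n → ℝ) :
    ∑ j : Fin n, q j * (-(ω₂ * q j) +
        (if h : j.val + 1 < n then q ⟨j.val + 1, h⟩ - q j else 0) -
        (if h : 0 < j.val then q j - q ⟨j.val - 1, by omega⟩ else q j)) ≤
      -(ω₂ * ∑ j : Fin n, q j ^ 2) := by
  have hre := hostBlock_sum_bond_reindex (n := n) (fun a b => q b * (q b - q a))
  have key : ∀ j : Fin n, q j * (-(ω₂ * q j) +
      (if h : j.val + 1 < n then q ⟨j.val + 1, h⟩ - q j else 0) -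
      (if h : 0 < j.val then q j - q ⟨j.val - 1, by omega⟩ else q j)) =
      -(ω₂ * q j ^ 2) + (if h : j.val + 1 < n then q j * (q ⟨j.val + 1, h⟩ - q j) else 0) -
        (if h : 0 < j.val then q j * (q j - q ⟨j.val - 1, by omega⟩) else 0) -
        (if 0 < j.val then 0 else q j ^ 2) := by
    intro j
    split_ifs <;> ring
  rw [Finset.sum_congr rfl fun j _ => key j, Finset.sum_sub_distrib, Finset.sum_sub_distrib,
    Finset.sum_add_distrib, hre, add_sub_assoc, ← Finset.sum_sub_distrib]
  have h1 : ∑ j : Fin n, ((if h : j.val + 1 < n then q j * (q ⟨j.val + 1, h⟩ - q j) else 0) -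
      (if h : j.val + 1 < n then q ⟨j.val + 1, h⟩ * (q ⟨j.val + 1, h⟩ - q j) else 0)) ≤ 0 := by
    refine Finset.sum_nonpos fun j _ => ?_
    split_ifs
    · nlinarith [sq_nonneg (q ⟨j.val + 1, by omega⟩ - q j)]
    · simp
  have h2 : 0 ≤ ∑ j : Fin n, (if 0 < j.val then 0 else q j ^ 2) :=
    Finset.sum_nonneg fun j _ => by split_ifs <;> positivity
  have h3 : ∑ j : Fin n, -(ω₂ * q j ^ 2) = -(ω₂ * ∑ j : Fin n, q j ^ 2) := by
    rw [Finset.mul_sum, ← Finset.sum_neg_distrib]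
  linarith

/-- **The static problem has only the trivial solution** (`ω₂ > 0`): if every component of the
block force vanishes, `F(q) = 0`, then `q = 0` (pair the virial inequality with `q`). [folklore] -/
theorem hostBlock_eq_zero_of_force_eq_zero {ω₂ : ℝ} (hω : 0 < ω₂) (q : Fin n → ℝ)
    (h : ∀ j : Fin n, -(ω₂ * q j) +
        (if h : j.val + 1 < n then q ⟨j.val + 1, h⟩ - q j else 0) -
        (if h : 0 < j.val then q j - q ⟨j.val - 1, by omega⟩ else q j) = 0) :
    q = 0 := by
  have hsum := hostBlock_sum_mul_force_le ω₂ q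
  have hzero : ∑ j : Fin n, q j * (-(ω₂ * q j) +
      (if h : j.val + 1 < n then q ⟨j.val + 1, h⟩ - q j else 0) -
      (if h : 0 < j.val then q j - q ⟨j.val - 1, by omega⟩ else q j)) = 0 :=
    Finset.sum_eq_zero fun j _ => by rw [h j, mul_zero]
  rw [hzero] at hsum
  have hS0 : 0 ≤ ∑ j : Fin n, q j ^ 2 := Finset.sum_nonneg fun j _ => sq_nonneg _
  have hS : ∑ j : Fin n, q j ^ 2 = 0 := by nlinarith
  funext j
  have hj := (Finset.sum_eq_zero_iff_of_nonneg fun i _ => sq_nonneg (q i)).1 hS j (Finset.mem_univ j)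
  exact pow_eq_zero_iff two_ne_zero |>.1 hj

/-! ### Rigidity: a resting last momentum forces the trivial initial condition -/

/-- **Observability of the damped harmonic block from its last momentum (rigidity).** Let `A` be
the block operator (`n ≥ 1`, `ω₂ > 0`, any `γ`). If along the free linear flow `X(t) = exp(tA) X₀`
the last momentum `p_{n-1}(t)` vanishes for all `t ∈ [0, τ]`, `τ > 0`, then `X₀ = 0`. Peeling
from the right: if `p_i ≡ 0` and `p_{i+1} ≡ 0` on `[0, τ]` then `0 = p̈_i = dF_i(q)/dt - [i = n-1] γ ṗ_i
= -ω₂ p_i + (p_{i+1} - p_i) - (p_i - p_{i-1}) = p_{i-1}`; so all momenta rest, all positions are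
frozen, and `F(q(0)) = ṗ(0) = 0` forces `q(0) = 0`.
[cite: CuneoEckmannHairerReyBellet2018, Prop 3.3] -/
theorem hostBlock_eq_zero_of_momentum_last_eq_zero (hn : 0 < n) {ω₂ γ τ : ℝ} (hω : 0 < ω₂)
    (hτ : 0 < τ) (A : PhaseSpace n →L[ℝ] PhaseSpace n)
    (hA : ∀ X : PhaseSpace n, A X = (X.2, fun j : Fin n => -(ω₂ * X.1 j) +
        (if h : j.val + 1 < n then X.1 ⟨j.val + 1, h⟩ - X.1 j else 0) -
        (if h : 0 < j.val then X.1 j - X.1 ⟨j.val - 1, by omega⟩ else X.1 j) -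
        (if j.val = n - 1 then γ * X.2 j else 0)))
    (X₀ : PhaseSpace n)
    (h0 : ∀ t ∈ Icc 0 τ, (exp (t • A) X₀).2 ⟨n - 1, by omega⟩ = 0) : X₀ = 0 := by
  set x : ℝ → PhaseSpace n := fun t => exp (t • A) X₀ with hx
  have hxd : ∀ t, HasDerivAt x (A (x t)) t := hasDerivAt_linearFlow A X₀
  have hAxd : ∀ t, HasDerivAt (fun s => A (x s)) (A (A (x t))) t := fun t =>
    A.hasFDerivAt.comp_hasDerivAt t (hxd t)
  have hA1 : ∀ Y : PhaseSpace n, (A Y).1 = Y.2 := fun Y => by rw [hA]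
  have hA2 : ∀ (Y : PhaseSpace n) (j : Fin n), (A Y).2 j = -(ω₂ * Y.1 j) +
      (if h : j.val + 1 < n then Y.1 ⟨j.val + 1, h⟩ - Y.1 j else 0) -
      (if h : 0 < j.val then Y.1 j - Y.1 ⟨j.val - 1, by omega⟩ else Y.1 j) -
      (if j.val = n - 1 then γ * Y.2 j else 0) := fun Y j => by rw [hA]
  -- component derivatives
  have hp' : ∀ (j : Fin n) (t : ℝ), HasDerivAt (fun s => (x s).2 j) ((A (x t)).2 j) t := by
    intro j t
    have h := (ContinuousLinearMap.snd ℝ (Fin n → ℝ) (Fin n → ℝ)).hasFDerivAt.comp_hasDerivAt t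
      (hxd t)
    exact hasDerivAt_pi.1 h j
  have hAp' : ∀ (j : Fin n) (t : ℝ),
      HasDerivAt (fun s => (A (x s)).2 j) ((A (A (x t))).2 j) t := by
    intro j t
    have h := (ContinuousLinearMap.snd ℝ (Fin n → ℝ) (Fin n → ℝ)).hasFDerivAt.comp_hasDerivAt t
      (hAxd t)
    exact hasDerivAt_pi.1 h j
  -- peeling from the right
  have hpeel : ∀ m : ℕ, m ≤ n → ∀ j : Fin n, n - m ≤ j.val →
      ∀ t ∈ Icc 0 τ, (x t).2 j = 0 := by
    intro m
    induction m with
    | zero =>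
      intro _ j hj
      exact absurd j.isLt (by omega)
    | succ m ih =>
      intro hm j hj
      by_cases hj' : n - m ≤ j.val
      · exact ih (by omega) j hj'
      · have hjv : j.val = n - (m + 1) := by omega
        rcases Nat.eq_zero_or_pos m with hm0 | hmpos
        · subst hm0
          have hjl : j = ⟨n - 1, by omega⟩ := Fin.ext (by rw [hjv])
          intro t ht
          rw [hjl]
          exact h0 t ht
        · have hi : n - m < n := by omega
          set i : Fin n := ⟨n - m, hi⟩ with hi_def
          have hpi : ∀ t ∈ Icc 0 τ, (x t).2 i = 0 := ih (by omega) i (by simp [hi_def])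
          have hpi1 : ∀ (h : i.val + 1 < n), ∀ t ∈ Icc 0 τ, (x t).2 ⟨i.val + 1, h⟩ = 0 :=
            fun h => ih (by omega) ⟨i.val + 1, h⟩ (by simp [hi_def])
          have hFi : ∀ t ∈ Icc 0 τ, (A (x t)).2 i = 0 :=
            deriv_eq_zero_of_eqOn_Icc hτ (fun σ _ => hp' i σ) hpi
          have hFFi : ∀ t ∈ Icc 0 τ, (A (A (x t))).2 i = 0 :=
            deriv_eq_zero_of_eqOn_Icc hτ (fun σ _ => hAp' i σ) hFi
          intro t ht
          have e := hFFi t ht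
          rw [hA2 (A (x t)) i, hA1 (x t), hFi t ht, hpi t ht] at e
          have hipos : 0 < i.val := by simp [hi_def]; omega
          have hd1 : (if h : i.val + 1 < n then (x t).2 ⟨i.val + 1, h⟩ - 0 else (0 : ℝ)) = 0 := by
            split_ifs with h
            · rw [hpi1 h t ht, sub_zero]
            · rfl
          have hd3 : (if i.val = n - 1 then γ * 0 else (0 : ℝ)) = 0 := by
            split_ifs <;> simp
          rw [hd1, dif_pos hipos, hd3] at e
          have hj_eq : j = ⟨i.val - 1, by omega⟩ := Fin.ext (by simp [hi_def]; omega)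
          rw [hj_eq]
          linarith
  have hall : ∀ (j : Fin n), ∀ t ∈ Icc 0 τ, (x t).2 j = 0 :=
    fun j => hpeel n le_rfl j (by omega)
  have hx0 : x 0 = X₀ := linearFlow_zero A X₀
  have h0mem : (0 : ℝ) ∈ Icc 0 τ := ⟨le_rfl, hτ.le⟩
  have hP0 : X₀.2 = 0 := by
    funext j
    have := hall j 0 h0mem
    rwa [hx0] at this
  have hF0 : ∀ j : Fin n, (A X₀).2 j = 0 := fun j => by
    have := deriv_eq_zero_of_eqOn_Icc hτ (fun σ _ => hp' j σ) (hall j) 0 h0mem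
    rwa [hx0] at this
  have hQ0 : X₀.1 = 0 := by
    refine hostBlock_eq_zero_of_force_eq_zero hω X₀.1 fun j => ?_
    have e := hF0 j
    rw [hA2, hP0] at e
    simpa using e
  exact Prod.ext hQ0 hP0

/-! ### The observability constant and the forced estimate -/

/-- **Observability inequality for the damped harmonic block**: along the free linear flow,
`∫₀^τ p_{n-1}(t)² dt ≥ c ‖X₀‖²` for one `c > 0` (`n ≥ 1`, `ω₂ > 0`, `τ > 0`; sup norm of phase
space). [folklore] -/
theorem hostBlock_exists_observabilityConstant (hn : 0 < n) {ω₂ γ τ : ℝ} (hω : 0 < ω₂)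
    (hτ : 0 < τ) (A : PhaseSpace n →L[ℝ] PhaseSpace n)
    (hA : ∀ X : PhaseSpace n, A X = (X.2, fun j : Fin n => -(ω₂ * X.1 j) +
        (if h : j.val + 1 < n then X.1 ⟨j.val + 1, h⟩ - X.1 j else 0) -
        (if h : 0 < j.val then X.1 j - X.1 ⟨j.val - 1, by omega⟩ else X.1 j) -
        (if j.val = n - 1 then γ * X.2 j else 0))) :
    ∃ c : ℝ, 0 < c ∧ ∀ X₀ : PhaseSpace n,
      c * ‖X₀‖ ^ 2 ≤ ∫ t in (0 : ℝ)..τ, ((exp (t • A) X₀).2 ⟨n - 1, by omega⟩) ^ 2 := by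
  set C : PhaseSpace n →L[ℝ] ℝ := (ContinuousLinearMap.proj (⟨n - 1, by omega⟩ : Fin n)).comp
    (ContinuousLinearMap.snd ℝ (Fin n → ℝ) (Fin n → ℝ)) with hC
  have hCap : ∀ Y : PhaseSpace n, C Y = Y.2 ⟨n - 1, by omega⟩ := fun Y => rfl
  obtain ⟨c, hc, h⟩ := exists_observabilityConstant A C hτ fun X₀ hX =>
    hostBlock_eq_zero_of_momentum_last_eq_zero hn hω hτ A hA X₀ fun t ht => by
      rw [← hCap]; exact hX t ht
  exact ⟨c, hc, fun X₀ => by simpa only [hCap] using h X₀⟩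

/-- **Observability of the damped harmonic block under bounded forcing.** For the block operator
`A` (`n ≥ 1`, `ω₂ > 0`, `τ > 0`) there are `c > 0`, `C ≥ 0` such that every continuous solution of
`X(t) = X(0) + (0, ξ(t) e_{n-1}) + ∫₀ᵗ (A X(s) + (0, u(s) e_0)) ds` on `[0, τ]`, with continuous
forcings `|u| ≤ Mu`, `|ξ| ≤ Mξ` there, satisfies
`c ‖X(0)‖² - C (Mu² + Mξ²) ≤ ∫₀^τ (p_{n-1}(s) - ξ(s))² ds`: the signal `p_{n-1} - ξ` is the last
momentum of `X - (0, ξ e_{n-1})`, which is within `O(Mξ + τ Mu) e^{‖A‖τ}` of the free flow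
(Grönwall), and the free flow is observed (`hostBlock_exists_observabilityConstant`). [folklore] -/
theorem hostBlock_observability_forced (hn : 0 < n) {ω₂ γ τ : ℝ} (hω : 0 < ω₂) (hτ : 0 < τ)
    (A : PhaseSpace n →L[ℝ] PhaseSpace n)
    (hA : ∀ X : PhaseSpace n, A X = (X.2, fun j : Fin n => -(ω₂ * X.1 j) +
        (if h : j.val + 1 < n then X.1 ⟨j.val + 1, h⟩ - X.1 j else 0) -
        (if h : 0 < j.val then X.1 j - X.1 ⟨j.val - 1, by omega⟩ else X.1 j) -
        (if j.val = n - 1 then γ * X.2 j else 0))) :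
    ∃ c C : ℝ, 0 < c ∧ 0 ≤ C ∧
      ∀ (Mu Mξ : ℝ) (u ξ : ℝ → ℝ) (X : ℝ → PhaseSpace n),
        Continuous u → Continuous ξ → Continuous X →
        (∀ t ∈ Icc (0 : ℝ) τ, |u t| ≤ Mu) → (∀ t ∈ Icc (0 : ℝ) τ, |ξ t| ≤ Mξ) →
        (∀ t ∈ Icc (0 : ℝ) τ,
          X t = X 0 + ((0 : Fin n → ℝ), fun j : Fin n => if j.val = n - 1 then ξ t else 0) +
            ∫ s in (0 : ℝ)..t,
              (A (X s) + ((0 : Fin n → ℝ), fun j : Fin n => if 0 < j.val then 0 else u s))) →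
        c * ‖X 0‖ ^ 2 - C * (Mu ^ 2 + Mξ ^ 2) ≤
          ∫ s in (0 : ℝ)..τ, ((X s).2 ⟨n - 1, by omega⟩ - ξ s) ^ 2 := by
  obtain ⟨c, hc, hobs⟩ := hostBlock_exists_observabilityConstant hn hω hτ A hA
  refine ⟨c / 2, τ * (2 * (2 + τ) ^ 2 * Real.exp (‖A‖ * τ) ^ 2), by positivity, by positivity,
    ?_⟩
  intro Mu Mξ u ξ X hu hξ hXc hMu hMξ hX
  have h0mem : (0 : ℝ) ∈ Icc 0 τ := ⟨le_rfl, hτ.le⟩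
  have hMu0 : 0 ≤ Mu := (abs_nonneg _).trans (hMu 0 h0mem)
  have hMξ0 : 0 ≤ Mξ := (abs_nonneg _).trans (hMξ 0 h0mem)
  set X₀ : PhaseSpace n := X 0 with hX₀
  set Nf : ℝ → PhaseSpace n := fun t =>
    ((0 : Fin n → ℝ), fun j : Fin n => if j.val = n - 1 then ξ t else 0) with hNf
  set bf : ℝ → PhaseSpace n := fun s =>
    ((0 : Fin n → ℝ), fun j : Fin n => if 0 < j.val then 0 else u s) with hbf
  -- sizes of the forcing vectors
  have hvec : ∀ (r : ℝ) (P : Fin n → Prop) [DecidablePred P],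
      ‖((0 : Fin n → ℝ), fun j : Fin n => if P j then r else 0)‖ ≤ |r| ∧
      ‖((0 : Fin n → ℝ), fun j : Fin n => if P j then 0 else r)‖ ≤ |r| := by
    intro r P _
    constructor
    · rw [Prod.norm_def, norm_zero]
      refine max_le (abs_nonneg r) ((pi_norm_le_iff_of_nonneg (abs_nonneg r)).2 fun j => ?_)
      dsimp only
      split_ifs <;> simp
    · rw [Prod.norm_def, norm_zero]
      refine max_le (abs_nonneg r) ((pi_norm_le_iff_of_nonneg (abs_nonneg r)).2 fun j => ?_)
      dsimp only
      split_ifs <;> simp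
  have hN : ∀ t, ‖Nf t‖ ≤ |ξ t| := fun t => (hvec (ξ t) (fun j : Fin n => j.val = n - 1)).1
  have hb : ∀ s, ‖bf s‖ ≤ |u s| := fun s => (hvec (u s) (fun j : Fin n => 0 < j.val)).2
  have hbc : Continuous bf := by
    refine continuous_const.prodMk (continuous_pi fun j => ?_)
    split_ifs
    exacts [continuous_const, hu]
  -- the forced integral equation
  have hX' : ∀ t ∈ Icc 0 τ, X t = X₀ + Nf t + ∫ s in (0 : ℝ)..t, (A (X s) + bf s) :=
    fun t ht => hX t ht
  set g : ℝ → PhaseSpace n := fun t => X₀ + Nf t + ∫ s in (0 : ℝ)..t, bf s with hg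
  have hsol : IsIntegralSolutionOn A g X τ := by
    intro t ht
    have hAXi : IntervalIntegrable (fun s => A (X s)) volume 0 t :=
      (A.continuous.comp hXc).intervalIntegrable 0 t
    have hbi : IntervalIntegrable (fun s => bf s) volume 0 t := hbc.intervalIntegrable 0 t
    show X t = X₀ + Nf t + (∫ s in (0 : ℝ)..t, bf s) + ∫ s in (0 : ℝ)..t, A (X s)
    rw [hX' t ht, intervalIntegral.integral_add hAXi hbi]
    abel
  have hδ : ∀ t ∈ Icc 0 τ, ‖g t - X₀‖ ≤ Mξ + τ * Mu := by
    intro t ht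
    have e : g t - X₀ = Nf t + ∫ s in (0 : ℝ)..t, bf s := by
      show X₀ + Nf t + (∫ s in (0 : ℝ)..t, bf s) - X₀ = _
      abel
    rw [e]
    refine (norm_add_le _ _).trans (add_le_add ((hN t).trans (hMξ t ht)) ?_)
    have h1 : ‖∫ s in (0 : ℝ)..t, bf s‖ ≤ Mu * |t - 0| := by
      refine intervalIntegral.norm_integral_le_of_norm_le_const fun s hs => ?_
      rw [uIoc_of_le ht.1] at hs
      exact (hb s).trans (hMu s ⟨hs.1.le, hs.2.trans ht.2⟩)
    rw [sub_zero, abs_of_nonneg ht.1] at h1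
    calc ‖∫ s in (0 : ℝ)..t, bf s‖ ≤ Mu * t := h1
      _ ≤ Mu * τ := mul_le_mul_of_nonneg_left ht.2 hMu0
      _ = τ * Mu := mul_comm _ _
  have hdev := hsol.norm_sub_linearFlow_le hXc hδ
  -- the observed signal and its distance to the free output
  set y : ℝ → ℝ := fun t => (X t).2 ⟨n - 1, by omega⟩ - ξ t with hy
  have hyc : Continuous y := ((continuous_apply _).comp (continuous_snd.comp hXc)).sub hξ
  have hac : Continuous fun t : ℝ => (exp (t • A) X₀).2 ⟨n - 1, by omega⟩ :=
    (continuous_apply _).comp (continuous_snd.comp (continuous_linearFlow A X₀))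
  set η : ℝ := (Mξ + τ * Mu) * Real.exp (‖A‖ * τ) + Mξ with hη
  have hηb : ∀ t ∈ Icc 0 τ, |y t - (exp (t • A) X₀).2 ⟨n - 1, by omega⟩| ≤ η := by
    intro t ht
    have e : y t - (exp (t • A) X₀).2 ⟨n - 1, by omega⟩ =
        (X t - exp (t • A) X₀).2 ⟨n - 1, by omega⟩ - ξ t := by
      simp only [hy, Prod.snd_sub, Pi.sub_apply]
      ring
    rw [e]
    refine (abs_sub _ _).trans (add_le_add ?_ (hMξ t ht))
    calc |(X t - exp (t • A) X₀).2 ⟨n - 1, by omega⟩|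
        ≤ ‖X t - exp (t • A) X₀‖ := by
          rw [← Real.norm_eq_abs]
          exact (norm_le_pi_norm _ _).trans (norm_snd_le _)
      _ ≤ (Mξ + τ * Mu) * Real.exp (‖A‖ * t) := hdev t ht
      _ ≤ (Mξ + τ * Mu) * Real.exp (‖A‖ * τ) := by
          have : Real.exp (‖A‖ * t) ≤ Real.exp (‖A‖ * τ) :=
            Real.exp_le_exp.2 (mul_le_mul_of_nonneg_left ht.2 (norm_nonneg _))
          exact mul_le_mul_of_nonneg_left this (by positivity)
  have hmain := integral_sq_ge_of_abs_sub_le hτ.le hac hyc hηb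
  -- sizes: `η² ≤ 2 (2+τ)² e^{2‖A‖τ} (Mu² + Mξ²)`
  have he1 : 1 ≤ Real.exp (‖A‖ * τ) := Real.one_le_exp (by positivity)
  have hη0 : 0 ≤ η := by positivity
  have hηle : η ≤ (2 + τ) * (Mξ + Mu) * Real.exp (‖A‖ * τ) := by
    have h1 : Mξ ≤ Mξ * Real.exp (‖A‖ * τ) := le_mul_of_one_le_right hMξ0 he1
    have h2 : (2 * Mξ + τ * Mu) ≤ (2 + τ) * (Mξ + Mu) := by nlinarith
    calc η ≤ (Mξ + τ * Mu) * Real.exp (‖A‖ * τ) + Mξ * Real.exp (‖A‖ * τ) := by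
          rw [hη]; linarith
      _ = (2 * Mξ + τ * Mu) * Real.exp (‖A‖ * τ) := by ring
      _ ≤ (2 + τ) * (Mξ + Mu) * Real.exp (‖A‖ * τ) :=
          mul_le_mul_of_nonneg_right h2 (by positivity)
  have hη2 : η ^ 2 ≤ 2 * (2 + τ) ^ 2 * Real.exp (‖A‖ * τ) ^ 2 * (Mu ^ 2 + Mξ ^ 2) := by
    have h1 : η ^ 2 ≤ ((2 + τ) * (Mξ + Mu) * Real.exp (‖A‖ * τ)) ^ 2 :=
      pow_le_pow_left₀ hη0 hηle 2
    have h2 : (Mξ + Mu) ^ 2 ≤ 2 * (Mu ^ 2 + Mξ ^ 2) := by nlinarith [sq_nonneg (Mξ - Mu)]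
    have h3 : 0 ≤ (2 + τ) ^ 2 * Real.exp (‖A‖ * τ) ^ 2 := by positivity
    calc η ^ 2 ≤ ((2 + τ) * (Mξ + Mu) * Real.exp (‖A‖ * τ)) ^ 2 := h1
      _ = (2 + τ) ^ 2 * Real.exp (‖A‖ * τ) ^ 2 * (Mξ + Mu) ^ 2 := by ring
      _ ≤ (2 + τ) ^ 2 * Real.exp (‖A‖ * τ) ^ 2 * (2 * (Mu ^ 2 + Mξ ^ 2)) :=
          mul_le_mul_of_nonneg_left h2 h3
      _ = 2 * (2 + τ) ^ 2 * Real.exp (‖A‖ * τ) ^ 2 * (Mu ^ 2 + Mξ ^ 2) := by ring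
  have hτη : τ * η ^ 2 ≤ τ * (2 * (2 + τ) ^ 2 * Real.exp (‖A‖ * τ) ^ 2) * (Mu ^ 2 + Mξ ^ 2) := by
    have := mul_le_mul_of_nonneg_left hη2 hτ.le
    linarith
  have hobs0 := hobs X₀
  linarith
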